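import Summits.QuantumFields.YangMills.Theorems.UnitScaleTiltProp7TrueLinReality
import HarnessLib

/-!
# Route `UnitScaleTilt`, crux K1 «MinimiserStabilityRegPr» (stmt-QuantumFields-19200), route-R [RP] curved, row (n3) F0, part 2 —
# REALITY OF THE FAMILIES OF RECORD: every recursion family `Q k` of the true linearisations, the (sourced) reduced family `G`, the coarse gauge function `Λ`
# and the plain sourced family `D` along the background tower `Ū₀^{(j)}` are `𝔰𝔲(N)`-valued when their data are

Cell `ym3-torus`, D-0154 (3c) twin-width seat `ym-routeR-w2` (gen 3); sequel of `UnitScaleTiltProp7TrueLinReality` (the one-step operator `T_V`, `CM_V`, `P_V`).  Row F0 of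
the namer's cut (★p1 g14 2026-08-28): the gauge correction `μ := −Λ_k` of the conserved-current reading of the JOINT row must be `𝔰𝔲(N)`-valued; here `Λ_k` (and the
families it is built from) are shown `𝔰𝔲(N)`-valued by induction along their DISPLAYED recursions (the letters of ✓ `Prop7CurvedLandauRowA.exists_trueLinIter_family` ∕
`exists_reduced_family` ∕ `exists_coarseGauge_family` and ✓ `Prop7TrueLinSourcedStructure.exists_sourced_reduced_family` ∕ `exists_sourced_family`, VERBATIM), under the
per-level (0.4) guards `dist1(W^{(j)}_i(c)) ≤ a_j < δ_N` (`j < k`) that every consumer already carries (`hα`, `haN`).  THEOREMS ONLY (0 `def`, 0 `sorry`);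
`--supports stmt-QuantumFields-19200`, count-neutral.  YM₃ on T³ is a ladder rung (R3), not the Clay problem; nothing here claims the stub, the crux, d = 4 or the mass gap.

WHAT IS PROVED (ns `…Theorems.Prop7TrueLinRealityFamilies`; `SU(n)`, any `P`).
* §0 `su_mlog_of_mem`, `su_mlog_pertVar_add_one` — the log(-ratio) letters the consumers feed in as data∕sources.
* ★★ `su_trueLinIter` — `∀ j ≤ k, ∀ c, Q j Y c ∈ 𝔰𝔲(N)` for `𝔰𝔲(N)`-valued `Y`.
* ★★ `su_sourcedReduced` — the sourced reduced family `G` (`G (k+1) = T_k(G k) − P(CM_k(G k)) + R k`) for `𝔰𝔲(N)`-valued datum `D₀` and sources `R j` (`j < k`); `su_reduced` (no sources).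
* ★★ `su_coarseGauge` — the coarse gauge function `Λ` (`Λ (k+1) z = CM_k(G k)(z) + Λ k (emb z)`) whenever `G j` (`j < k`) is `𝔰𝔲(N)`-valued — no guard needed.
* `su_sourced` — the plain sourced family `D (k+1) = T_k(D k) + R k`.
HONEST SCOPE.  Inductions over the one-step letters; nothing of print is asserted.

References: T. Bałaban, CMP 95 (1984) 17–40 [Balaban1984PropagatorsI] ((1.18)–(1.20) pp.19–20); CMP 99 (1985) 389–434 [Balaban1985BackgroundPropagators] ((3.13)–(3.14) p.393);
CMP 98 (1985) 17–51 [Balaban1985Averaging] ((11) p.19); CMP 102 (1985) 277–309 [Balaban1985Variational] ((51) p.286).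
-/

set_option autoImplicit false

noncomputable section

open scoped BigOperators Matrix.Norms.L2Operator

namespace Summit.QuantumFields.YangMills.Theorems.Prop7TrueLinRealityFamilies

open Literature.MathematicalPhysics.QuantumFieldTheory.Balaban1983to89
open Finset T4Continuum BlockAveraging AveragingRT ExpMeanLog BlockAveragingEMLLinearised BlockAveragingEMLLinearisedBackground BlockAveragingEMLProp2
open MatrixLog (mlog)
open Summit.QuantumFields.YangMills.Theorems.Prop7TrueLinReality (su_zero su_add su_sub su_trueLin su_covCombMean su_pureGauge guard_facts)

variable {n : Type*} [Fintype n] [DecidableEq n] [Nonempty n] {P : Params}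

/-! ## §4 ★★ The families of record along the background tower `Ū₀^{(j)}` -/

/-! ## §0 Two letters for the consumers: `log` of an `SU(N)` matrix ∕ of a level ratio on the (0.4) guard is `𝔰𝔲(N)`-valued -/

/-- `log X ∈ 𝔰𝔲(N)` for `X ∈ SU(N)` with `‖X − 1‖ < δ_N` (✓ `star_mlog_eq_neg`, ✓ `trace_mlog_eq_zero`). [cite: Balaban1987RG1, (0.4) p.253; Balaban1985Averaging, (23) p.21] -/
theorem su_mlog_of_mem {X : Matrix n n ℂ} (hX : X ∈ Matrix.specialUnitaryGroup n ℂ) (h1 : ‖X - 1‖ < deltaSU n) :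
    star (mlog X) = -mlog X ∧ (mlog X).trace = 0 :=
  ⟨star_mlog_eq_neg (Matrix.mem_specialUnitaryGroup_iff.1 hX).1 (guard_facts h1).1, trace_mlog_eq_zero hX (guard_facts h1).1 (guard_facts h1).2⟩

/-- The LOG-RATIO field `X = log(W_bV_b*) = mlog(pertVar V W b + 1)` of two `SU(N)` fields is `𝔰𝔲(N)`-valued at every bond where `‖W_bV_b* − 1‖ < δ_N` (the datum `X_j`
and the one-step images `X_{j+1}` of ✓ `Prop7FibreLogRatioL1`, hence its sources `R_j = X_{j+1} − T_jX_j` with §3 of part 1). [cite: Balaban1985Variational, (15) p.280; Balaban1987RG1, (0.4) p.253] -/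
theorem su_mlog_pertVar_add_one {j : ℕ} (V W : GaugeField P j (Matrix.specialUnitaryGroup n ℂ)) (b : PBond P j)
    (h1 : ‖pertVar V W b‖ < deltaSU n) :
    star (mlog (pertVar V W b + 1)) = -mlog (pertVar V W b + 1) ∧ (mlog (pertVar V W b + 1)).trace = 0 := by
  have hmem : pertVar V W b + 1 ∈ Matrix.specialUnitaryGroup n ℂ := by
    rw [pertVar, sub_add_cancel]; exact (W b * (V b)⁻¹).prop
  have h1' : ‖(pertVar V W b + 1) - 1‖ < deltaSU n := by rwa [add_sub_cancel_right]
  exact su_mlog_of_mem hmem h1'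

section Families

/-- ★★ **EVERY RECURSION FAMILY `Q` OF THE TRUE LINEARISATIONS MAPS `𝔰𝔲(N)`-VALUED FIELDS TO `𝔰𝔲(N)`-VALUED FIELDS** (`hQ0`∕`hQs` = the letters of
✓ `Prop7CurvedLandauRowA.exists_trueLinIter_family`), at every level `j ≤ k` under the per-level (0.4) guards `dist1(W^{(j)}_i(c)) ≤ a_j < δ_N` (`j < k`).
[cite: Balaban1985BackgroundPropagators, (3.13)-(3.14) p.393; Balaban1984PropagatorsI, (1.18)-(1.20) pp.19-20] -/
theorem su_trueLinIter (U₀ : GaugeField P 0 (Matrix.specialUnitaryGroup n ℂ))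
    (Q : (k : ℕ) → (PBond P 0 → Matrix n n ℂ) → PBond P k → Matrix n n ℂ) (hQ0 : ∀ Y, Q 0 Y = Y)
    (hQs : ∀ (k : ℕ) (Y : PBond P 0 → Matrix n n ℂ) (c : PBond P (k + 1)), Q (k + 1) Y c
      = (fderiv ℂ (eml : (Idx P → Matrix n n ℂ) → Matrix n n ℂ)
            (fun i => ((loopHol (Averaging.iter (fun i => blockAvg (P := P) (j := i) (expMeanLogSU (n := n))) k U₀) c i : Matrix.specialUnitaryGroup n ℂ) : Matrix n n ℂ))
            (fun i => covWalkSum (Averaging.iter (fun i => blockAvg (P := P) (j := i) (expMeanLogSU (n := n))) k U₀) (Q k Y) (walk (emb c.src) (loopWord P.L c.dir (off i.1) i.2.1 i.2.2))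
              * ((loopHol (Averaging.iter (fun i => blockAvg (P := P) (j := i) (expMeanLogSU (n := n))) k U₀) c i : Matrix.specialUnitaryGroup n ℂ) : Matrix n n ℂ))
            * star ((corr (expMeanLogSU (n := n)) (Averaging.iter (fun i => blockAvg (P := P) (j := i) (expMeanLogSU (n := n))) k U₀) c : Matrix.specialUnitaryGroup n ℂ) : Matrix n n ℂ)
          + ((corr (expMeanLogSU (n := n)) (Averaging.iter (fun i => blockAvg (P := P) (j := i) (expMeanLogSU (n := n))) k U₀) c : Matrix.specialUnitaryGroup n ℂ) : Matrix n n ℂ)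
            * covWalkSum (Averaging.iter (fun i => blockAvg (P := P) (j := i) (expMeanLogSU (n := n))) k U₀) (Q k Y) (walk (emb c.src) (List.replicate P.L (c.dir, true)))
            * star ((corr (expMeanLogSU (n := n)) (Averaging.iter (fun i => blockAvg (P := P) (j := i) (expMeanLogSU (n := n))) k U₀) c : Matrix.specialUnitaryGroup n ℂ) : Matrix n n ℂ)))
    {k : ℕ} (a : ℕ → ℝ)
    (hα : ∀ j < k, ∀ (c : PBond P (j + 1)) (i : Idx P), dist1 (loopHol (Averaging.iter (fun i => blockAvg (P := P) (j := i) (expMeanLogSU (n := n))) j U₀) c i) ≤ a j)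
    (haN : ∀ j < k, a j < deltaSU n)
    {Y : PBond P 0 → Matrix n n ℂ} (hY : ∀ b, star (Y b) = -Y b ∧ (Y b).trace = 0) :
    ∀ j ≤ k, ∀ c : PBond P j, star (Q j Y c) = -Q j Y c ∧ (Q j Y c).trace = 0 := by
  intro j
  induction j with
  | zero => intro _ c; rw [hQ0]; exact hY c
  | succ j ih =>
    intro hj c
    rw [hQs]
    exact su_trueLin _ (fun b => ih (by omega) b) c (fun i => (hα j (by omega) c i).trans_lt (haN j (by omega)))

/-- ★★ **THE SOURCED REDUCED FAMILY IS `𝔰𝔲(N)`-VALUED** (`G 0 = D₀`, `G (k+1) c = T_k(G k)(c) − P_{Ū₀^{(k+1)}}(CM_k(G k))(c) + R k c`, the letters of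
✓ `Prop7TrueLinSourcedStructure.exists_sourced_reduced_family`) when the datum `D₀` and the sources `R j` (`j < k`) are, under the per-level (0.4) guards.
[cite: Balaban1984PropagatorsI, (1.18)-(1.20) pp.19-20; Balaban1985Averaging, (11) p.19] -/
theorem su_sourcedReduced (U₀ : GaugeField P 0 (Matrix.specialUnitaryGroup n ℂ)) {D₀ : PBond P 0 → Matrix n n ℂ}
    (hD₀ : ∀ b, star (D₀ b) = -D₀ b ∧ (D₀ b).trace = 0)
    (R : (k : ℕ) → PBond P (k + 1) → Matrix n n ℂ)
    (G : (k : ℕ) → PBond P k → Matrix n n ℂ) (hG0 : ∀ b, G 0 b = D₀ b)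
    (hGs : ∀ (k : ℕ) (c : PBond P (k + 1)), G (k + 1) c
      = (fderiv ℂ (eml : (Idx P → Matrix n n ℂ) → Matrix n n ℂ)
            (fun i => ((loopHol (Averaging.iter (fun i => blockAvg (P := P) (j := i) (expMeanLogSU (n := n))) k U₀) c i : Matrix.specialUnitaryGroup n ℂ) : Matrix n n ℂ))
            (fun i => covWalkSum (Averaging.iter (fun i => blockAvg (P := P) (j := i) (expMeanLogSU (n := n))) k U₀) (G k) (walk (emb c.src) (loopWord P.L c.dir (off i.1) i.2.1 i.2.2))
              * ((loopHol (Averaging.iter (fun i => blockAvg (P := P) (j := i) (expMeanLogSU (n := n))) k U₀) c i : Matrix.specialUnitaryGroup n ℂ) : Matrix n n ℂ))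
            * star ((corr (expMeanLogSU (n := n)) (Averaging.iter (fun i => blockAvg (P := P) (j := i) (expMeanLogSU (n := n))) k U₀) c : Matrix.specialUnitaryGroup n ℂ) : Matrix n n ℂ)
          + ((corr (expMeanLogSU (n := n)) (Averaging.iter (fun i => blockAvg (P := P) (j := i) (expMeanLogSU (n := n))) k U₀) c : Matrix.specialUnitaryGroup n ℂ) : Matrix n n ℂ)
            * covWalkSum (Averaging.iter (fun i => blockAvg (P := P) (j := i) (expMeanLogSU (n := n))) k U₀) (G k) (walk (emb c.src) (List.replicate P.L (c.dir, true)))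
            * star ((corr (expMeanLogSU (n := n)) (Averaging.iter (fun i => blockAvg (P := P) (j := i) (expMeanLogSU (n := n))) k U₀) c : Matrix.specialUnitaryGroup n ℂ) : Matrix n n ℂ))
          - ((((Fintype.card (Idx P) : ℂ))⁻¹ • ∑ i : Idx P,
                covWalkSum (Averaging.iter (fun i => blockAvg (P := P) (j := i) (expMeanLogSU (n := n))) k U₀) (G k) (walk (emb c.src) (stairWord i.2.1 (off i.1))))
              - ((Averaging.iter (fun i => blockAvg (P := P) (j := i) (expMeanLogSU (n := n))) (k + 1) U₀) c : Matrix.specialUnitaryGroup n ℂ) * (((Fintype.card (Idx P) : ℂ))⁻¹ • ∑ i : Idx P,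
                covWalkSum (Averaging.iter (fun i => blockAvg (P := P) (j := i) (expMeanLogSU (n := n))) k U₀) (G k) (walk (emb c.tgt) (stairWord i.2.1 (off i.1))))
                * star (((Averaging.iter (fun i => blockAvg (P := P) (j := i) (expMeanLogSU (n := n))) (k + 1) U₀) c : Matrix.specialUnitaryGroup n ℂ) : Matrix n n ℂ))
          + R k c)
    {k : ℕ} (a : ℕ → ℝ)
    (hα : ∀ j < k, ∀ (c : PBond P (j + 1)) (i : Idx P), dist1 (loopHol (Averaging.iter (fun i => blockAvg (P := P) (j := i) (expMeanLogSU (n := n))) j U₀) c i) ≤ a j)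
    (haN : ∀ j < k, a j < deltaSU n)
    (hR : ∀ j < k, ∀ c : PBond P (j + 1), star (R j c) = -R j c ∧ (R j c).trace = 0) :
    ∀ j ≤ k, ∀ c : PBond P j, star (G j c) = -G j c ∧ (G j c).trace = 0 := by
  intro j
  induction j with
  | zero => intro _ c; rw [hG0]; exact hD₀ c
  | succ j ih =>
    intro hj c
    have ih' : ∀ b : PBond P j, star (G j b) = -G j b ∧ (G j b).trace = 0 := fun b => ih (by omega) b
    rw [hGs]
    refine su_add (su_sub (su_trueLin _ ih' c (fun i => (hα j (by omega) c i).trans_lt (haN j (by omega)))) ?_) (hR j (by omega) c)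
    exact su_pureGauge _ (su_covCombMean _ ih' _) (su_covCombMean _ ih' _) c

/-- **THE REDUCED FAMILY (no sources) IS `𝔰𝔲(N)`-VALUED** (`G 0 = Y`, `G (k+1) c = T_k(G k)(c) − P_{Ū₀^{(k+1)}}(CM_k(G k))(c)`, the letters of
✓ `Prop7CurvedLandauRowA.exists_reduced_family`) when `Y` is, under the per-level (0.4) guards. [cite: Balaban1984PropagatorsI, (1.18)-(1.20) pp.19-20; Balaban1985Averaging, (11) p.19] -/
theorem su_reduced (U₀ : GaugeField P 0 (Matrix.specialUnitaryGroup n ℂ)) {Y : PBond P 0 → Matrix n n ℂ}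
    (hY : ∀ b, star (Y b) = -Y b ∧ (Y b).trace = 0)
    (G : (k : ℕ) → PBond P k → Matrix n n ℂ) (hG0 : ∀ b, G 0 b = Y b)
    (hGs : ∀ (k : ℕ) (c : PBond P (k + 1)), G (k + 1) c
      = (fderiv ℂ (eml : (Idx P → Matrix n n ℂ) → Matrix n n ℂ)
            (fun i => ((loopHol (Averaging.iter (fun i => blockAvg (P := P) (j := i) (expMeanLogSU (n := n))) k U₀) c i : Matrix.specialUnitaryGroup n ℂ) : Matrix n n ℂ))
            (fun i => covWalkSum (Averaging.iter (fun i => blockAvg (P := P) (j := i) (expMeanLogSU (n := n))) k U₀) (G k) (walk (emb c.src) (loopWord P.L c.dir (off i.1) i.2.1 i.2.2))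
              * ((loopHol (Averaging.iter (fun i => blockAvg (P := P) (j := i) (expMeanLogSU (n := n))) k U₀) c i : Matrix.specialUnitaryGroup n ℂ) : Matrix n n ℂ))
            * star ((corr (expMeanLogSU (n := n)) (Averaging.iter (fun i => blockAvg (P := P) (j := i) (expMeanLogSU (n := n))) k U₀) c : Matrix.specialUnitaryGroup n ℂ) : Matrix n n ℂ)
          + ((corr (expMeanLogSU (n := n)) (Averaging.iter (fun i => blockAvg (P := P) (j := i) (expMeanLogSU (n := n))) k U₀) c : Matrix.specialUnitaryGroup n ℂ) : Matrix n n ℂ)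
            * covWalkSum (Averaging.iter (fun i => blockAvg (P := P) (j := i) (expMeanLogSU (n := n))) k U₀) (G k) (walk (emb c.src) (List.replicate P.L (c.dir, true)))
            * star ((corr (expMeanLogSU (n := n)) (Averaging.iter (fun i => blockAvg (P := P) (j := i) (expMeanLogSU (n := n))) k U₀) c : Matrix.specialUnitaryGroup n ℂ) : Matrix n n ℂ))
          - ((((Fintype.card (Idx P) : ℂ))⁻¹ • ∑ i : Idx P,
                covWalkSum (Averaging.iter (fun i => blockAvg (P := P) (j := i) (expMeanLogSU (n := n))) k U₀) (G k) (walk (emb c.src) (stairWord i.2.1 (off i.1))))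
              - ((Averaging.iter (fun i => blockAvg (P := P) (j := i) (expMeanLogSU (n := n))) (k + 1) U₀) c : Matrix.specialUnitaryGroup n ℂ) * (((Fintype.card (Idx P) : ℂ))⁻¹ • ∑ i : Idx P,
                covWalkSum (Averaging.iter (fun i => blockAvg (P := P) (j := i) (expMeanLogSU (n := n))) k U₀) (G k) (walk (emb c.tgt) (stairWord i.2.1 (off i.1))))
                * star (((Averaging.iter (fun i => blockAvg (P := P) (j := i) (expMeanLogSU (n := n))) (k + 1) U₀) c : Matrix.specialUnitaryGroup n ℂ) : Matrix n n ℂ)))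
    {k : ℕ} (a : ℕ → ℝ)
    (hα : ∀ j < k, ∀ (c : PBond P (j + 1)) (i : Idx P), dist1 (loopHol (Averaging.iter (fun i => blockAvg (P := P) (j := i) (expMeanLogSU (n := n))) j U₀) c i) ≤ a j)
    (haN : ∀ j < k, a j < deltaSU n) :
    ∀ j ≤ k, ∀ c : PBond P j, star (G j c) = -G j c ∧ (G j c).trace = 0 := by
  intro j
  induction j with
  | zero => intro _ c; rw [hG0]; exact hY c
  | succ j ih =>
    intro hj c
    have ih' : ∀ b : PBond P j, star (G j b) = -G j b ∧ (G j b).trace = 0 := fun b => ih (by omega) b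
    rw [hGs]
    refine su_sub (su_trueLin _ ih' c (fun i => (hα j (by omega) c i).trans_lt (haN j (by omega)))) ?_
    exact su_pureGauge _ (su_covCombMean _ ih' _) (su_covCombMean _ ih' _) c

/-- ★★ **THE COARSE GAUGE FUNCTION OF RECORD IS `𝔰𝔲(N)`-VALUED** (`Λ 0 = 0`, `Λ (k+1) z = CM_k(G k)(z) + Λ k (emb z)`, the letters of
✓ `Prop7CurvedLandauRowA.exists_coarseGauge_family`) whenever the family `G` it is built from is `𝔰𝔲(N)`-valued at the levels `j < k` — no guard needed.
[cite: Balaban1984PropagatorsI, (1.18)-(1.20) pp.19-20] -/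
theorem su_coarseGauge (U₀ : GaugeField P 0 (Matrix.specialUnitaryGroup n ℂ)) (G : (k : ℕ) → PBond P k → Matrix n n ℂ)
    (Λ : (k : ℕ) → Site P k → Matrix n n ℂ) (hΛ0 : ∀ y, Λ 0 y = 0)
    (hΛs : ∀ (k : ℕ) (z : Site P (k + 1)), Λ (k + 1) z
      = (((Fintype.card (Idx P) : ℂ))⁻¹ • ∑ i : Idx P,
                covWalkSum (Averaging.iter (fun i => blockAvg (P := P) (j := i) (expMeanLogSU (n := n))) k U₀) (G k) (walk (emb z) (stairWord i.2.1 (off i.1))))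
        + Λ k (emb z))
    {k : ℕ} (hG : ∀ j < k, ∀ c : PBond P j, star (G j c) = -G j c ∧ (G j c).trace = 0) :
    ∀ j ≤ k, ∀ z : Site P j, star (Λ j z) = -Λ j z ∧ (Λ j z).trace = 0 := by
  intro j
  induction j with
  | zero => intro _ z; rw [hΛ0]; exact su_zero
  | succ j ih =>
    intro hj z
    rw [hΛs]
    exact su_add (su_covCombMean _ (hG j (by omega)) z) (ih (by omega) (emb z))

/-- **THE PLAIN SOURCED FAMILY IS `𝔰𝔲(N)`-VALUED** (`D 0 = D₀`, `D (k+1) c = T_k(D k)(c) + R k c`, the letters of ✓ `Prop7TrueLinSourcedStructure.exists_sourced_family`)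
when `D₀` and the sources are, under the per-level (0.4) guards. [cite: Balaban1984PropagatorsI, (1.18)-(1.20) pp.19-20] -/
theorem su_sourced (U₀ : GaugeField P 0 (Matrix.specialUnitaryGroup n ℂ)) {D₀ : PBond P 0 → Matrix n n ℂ}
    (hD₀ : ∀ b, star (D₀ b) = -D₀ b ∧ (D₀ b).trace = 0)
    (R : (k : ℕ) → PBond P (k + 1) → Matrix n n ℂ)
    (D : (k : ℕ) → PBond P k → Matrix n n ℂ) (hD0 : ∀ b, D 0 b = D₀ b)
    (hDs : ∀ (k : ℕ) (c : PBond P (k + 1)), D (k + 1) c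
      = (fderiv ℂ (eml : (Idx P → Matrix n n ℂ) → Matrix n n ℂ)
            (fun i => ((loopHol (Averaging.iter (fun i => blockAvg (P := P) (j := i) (expMeanLogSU (n := n))) k U₀) c i : Matrix.specialUnitaryGroup n ℂ) : Matrix n n ℂ))
            (fun i => covWalkSum (Averaging.iter (fun i => blockAvg (P := P) (j := i) (expMeanLogSU (n := n))) k U₀) (D k) (walk (emb c.src) (loopWord P.L c.dir (off i.1) i.2.1 i.2.2))
              * ((loopHol (Averaging.iter (fun i => blockAvg (P := P) (j := i) (expMeanLogSU (n := n))) k U₀) c i : Matrix.specialUnitaryGroup n ℂ) : Matrix n n ℂ))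
            * star ((corr (expMeanLogSU (n := n)) (Averaging.iter (fun i => blockAvg (P := P) (j := i) (expMeanLogSU (n := n))) k U₀) c : Matrix.specialUnitaryGroup n ℂ) : Matrix n n ℂ)
          + ((corr (expMeanLogSU (n := n)) (Averaging.iter (fun i => blockAvg (P := P) (j := i) (expMeanLogSU (n := n))) k U₀) c : Matrix.specialUnitaryGroup n ℂ) : Matrix n n ℂ)
            * covWalkSum (Averaging.iter (fun i => blockAvg (P := P) (j := i) (expMeanLogSU (n := n))) k U₀) (D k) (walk (emb c.src) (List.replicate P.L (c.dir, true)))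
            * star ((corr (expMeanLogSU (n := n)) (Averaging.iter (fun i => blockAvg (P := P) (j := i) (expMeanLogSU (n := n))) k U₀) c : Matrix.specialUnitaryGroup n ℂ) : Matrix n n ℂ)) + R k c)
    {k : ℕ} (a : ℕ → ℝ)
    (hα : ∀ j < k, ∀ (c : PBond P (j + 1)) (i : Idx P), dist1 (loopHol (Averaging.iter (fun i => blockAvg (P := P) (j := i) (expMeanLogSU (n := n))) j U₀) c i) ≤ a j)
    (haN : ∀ j < k, a j < deltaSU n)
    (hR : ∀ j < k, ∀ c : PBond P (j + 1), star (R j c) = -R j c ∧ (R j c).trace = 0) :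
    ∀ j ≤ k, ∀ c : PBond P j, star (D j c) = -D j c ∧ (D j c).trace = 0 := by
  intro j
  induction j with
  | zero => intro _ c; rw [hD0]; exact hD₀ c
  | succ j ih =>
    intro hj c
    rw [hDs]
    exact su_add (su_trueLin _ (fun b => ih (by omega) b) c (fun i => (hα j (by omega) c i).trans_lt (haN j (by omega)))) (hR j (by omega) c)

end Families

end Summit.QuantumFields.YangMills.Theorems.Prop7TrueLinRealityFamilies

end
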